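import Mathlib
import Summits.ResolutionOfSingularities.ResolutionOfSingularities.Theorems.FrobeniusClosingSteerLowOrderFirst

/-!
# Crux `Steer` (stmt-ResolutionOfSingularities-16345), σ-residual LOW half at `p = 2`:
# `lowOrder_step_two`, SECOND-ORDER engine (normal form ⇒ contradiction)

OURS (campaign `res-hironaka`, rung L ★L-G4, slot W4.1, chain W4.1; seat `res-D-pv-028` g6, res-L0-w41-plan-1 RULING 15
(15b); replaces the role of no printed item; NOT a statement of the manuscript under review [claim: Hironaka2017,
status: under-review]; AI review is weaker than expert review). Setting of `…SteerLowOrderFirst` (first-order engine).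

* `false_of_normalForm` — **SECOND ORDER**: if the coefficient matrix `G` of `F = f − g_σ²` in the rsop part `u`
  is in NORMAL FORM (one off-diagonal UNIT entry `G j₁ j₂`, every other off-diagonal entry in `𝔪_R`) and some cleaning
  of the transformed radicand lies in `𝔫³`, contradiction: the first-order engine gives `v̄_{j₁} = v̄_{j₂} = 0`; then
  `f₁ − g'² = S² + (mu v_{j₁}) · v_{j₂} + Θ` with `Θ ∈ J ∩ 𝔫² = J𝔫`, the classes of `mu v_{j₁}, v_{j₂}, x', w_l` are
  independent in `𝔫/𝔫²` (proportionality again), so they start a regular system of parameters of `R₁`, and layer 1's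
  cross-term detector `cross_term_not_mem_pow_three` forbids `S² + z₁ (v j₂) + Σ z_l a_l ∈ 𝔫³`;
(The rank-four case at a point step is the sibling file `…SteerLowOrderRankFour`.)
[cite: Matsumura1987, Thm. 17.10] [folklore]
-/

-- The namespace mirrors the chain's helper layout (`…Theorems.SwitchingDichotomy.<Piece>`) on purpose.
set_option linter.dupNamespace false

noncomputable section

namespace Summit.ResolutionOfSingularities.ResolutionOfSingularities.Theorems.SwitchingDichotomy.LowOrderSecond

open IsLocalRing Module Literature.AlgebraicGeometry.Resolution
open Summit.ResolutionOfSingularities.ResolutionOfSingularities.Theorems.SwitchingDichotomy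
open Summit.ResolutionOfSingularities.ResolutionOfSingularities.Theorems.SwitchingDichotomy.LowOrderFirst

universe u

variable {K : Type u} [Field K] [CharP K 2]
variable {R R₁ : Subring K} [IsLocalRing R] [IsRegularLocalRing R₁] (hRR₁ : R ≤ R₁)
  (hloc : ∀ m : R, m ∈ maximalIdeal R → residue R₁ (Subring.inclusion hRR₁ m) = 0)
  (hperf : ∀ a : R, ∃ b : R, a - b ^ 2 ∈ maximalIdeal R)
  {h e : ℕ} (u : Fin h → R) (w : Fin e → R)
  (huw : Ideal.span (Set.range u ∪ Set.range w) = maximalIdeal R)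
  (x' : R₁) (hx'm : x' ∈ maximalIdeal R₁) (hx'0 : x' ≠ 0)
  (v : Fin h → R₁) (hv : ∀ j, Subring.inclusion hRR₁ (u j) = x' * v j)
  (c : Fin h → R) (hc : Subring.inclusion hRR₁ (∑ j, c j * u j) = x')
  (δ : R₁ → CotangentSpace R₁)
  (hδadd : ∀ a b : R₁, δ (a + b) = δ a + δ b)
  (hδmul : ∀ a b : R₁, δ (a * b) = residue R₁ a • δ b + residue R₁ b • δ a)
  (hδmem : ∀ (m : R₁) (hm : m ∈ maximalIdeal R₁), δ m = (maximalIdeal R₁).toCotangent ⟨m, hm⟩)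
  (hδsq : ∀ b : R₁, δ (b ^ 2) = 0)
  (hdim₁ : finrank (ResidueField R₁) (CotangentSpace R₁) = 4) (hhe : h + e = 4)
  (hspan : Submodule.span (ResidueField R₁)
    (Set.range (fun a : R => δ ⟨a, hRR₁ a.2⟩) ∪ Set.range (fun j => δ (v j))) = ⊤)
  (G : Fin h → Fin h → R) (θ G' f₁ : R₁)
  (hθ : θ ∈ Ideal.span (Set.range (Fin.cons x' (fun l => Subring.inclusion hRR₁ (w l)) : Fin (e + 1) → R₁)))
  (hf₁ : f₁ = ∑ j, ∑ k, Subring.inclusion hRR₁ (G j k) * v j * v k + θ + G' ^ 2)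

/-! ## Residues of the coefficient matrix -/

omit [CharP K 2] in
include hloc in
/-- Off-diagonal entries in `𝔪_R` have residue `0` in `R₁`. [folklore] -/
theorem residue_inclusion_eq_zero {a : R} (ha : a ∈ maximalIdeal R) :
    residue R₁ (Subring.inclusion hRR₁ a) = 0 := hloc a ha

omit [IsLocalRing R] in
/-- Diagonal contributions `G j j + G j j` vanish in characteristic `2`. [folklore] -/
theorem add_self_eq_zero' (a : R) : a + a = 0 := CharTwo.add_self_eq_zero a

include hloc in
/-- **The kernel equation at a normal-form column**: if every off-diagonal entry of column/row `k` except the pair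
with `j₀` has residue `0`, the kernel equation at `k` reads `(Ḡ j₀ k + Ḡ k j₀) · v̄ j₀ = 0`. [folklore] -/
theorem kernel_single (j₀ k : Fin h) (hjk : j₀ ≠ k)
    (hoffk : ∀ j, j ≠ k → j ≠ j₀ → G j k ∈ maximalIdeal R ∧ G k j ∈ maximalIdeal R)
    (hker : ∑ j, residue R₁ (Subring.inclusion hRR₁ (G j k + G k j)) * residue R₁ (v j) = 0) :
    residue R₁ (Subring.inclusion hRR₁ (G j₀ k + G k j₀)) * residue R₁ (v j₀) = 0 := by
  rw [Finset.sum_eq_single j₀] at hker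
  · exact hker
  · intro j _ hj
    by_cases hjk' : j = k
    · subst hjk'
      rw [add_self_eq_zero' (G j j), map_zero, map_zero, zero_mul]
    · obtain ⟨h1, h2⟩ := hoffk j hjk' hj
      rw [residue_inclusion_eq_zero hRR₁ hloc (add_mem h1 h2), zero_mul]
  · intro h0; exact absurd (Finset.mem_univ j₀) h0

/-! ## The inclusion maps `𝔪_R` into `J = (x', w)` -/

omit [CharP K 2] [IsRegularLocalRing R₁] in
include huw hv in
/-- `ι(𝔪_R) ⊆ J = (x', ι w_l)`: `ι u_j = x' · v_j` and `ι w_l` are in `J`. [folklore] -/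
theorem inclusion_mem_J {m : R} (hm : m ∈ maximalIdeal R) :
    Subring.inclusion hRR₁ m ∈
      Ideal.span (Set.range (Fin.cons x' (fun l => Subring.inclusion hRR₁ (w l)) : Fin (e + 1) → R₁)) := by
  set J := Ideal.span (Set.range (Fin.cons x' (fun l => Subring.inclusion hRR₁ (w l)) : Fin (e + 1) → R₁)) with hJ
  have hx'J : x' ∈ J := Ideal.subset_span ⟨0, by simp⟩
  have hwJ : ∀ l, Subring.inclusion hRR₁ (w l) ∈ J := fun l => Ideal.subset_span ⟨l.succ, by simp⟩
  rw [← huw] at hm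
  induction hm using Submodule.span_induction with
  | mem y hy =>
    rcases hy with ⟨j, rfl⟩ | ⟨l, rfl⟩
    · rw [hv j]; exact Ideal.mul_mem_right _ _ hx'J
    · exact hwJ l
  | zero => simp
  | add y z _ _ hy hz => rw [map_add]; exact add_mem hy hz
  | smul a y _ hy => rw [smul_eq_mul, map_mul]; exact Ideal.mul_mem_left _ _ hy

omit [CharP K 2] in
include hloc hx'm huw in
/-- `J ≤ 𝔫`. [folklore] -/
theorem J_le_maximalIdeal :
    Ideal.span (Set.range (Fin.cons x' (fun l => Subring.inclusion hRR₁ (w l)) : Fin (e + 1) → R₁)) ≤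
      maximalIdeal R₁ := by
  rw [Ideal.span_le]
  rintro _ ⟨i, rfl⟩
  refine Fin.cases ?_ (fun l => ?_) i
  · simpa using hx'm
  · have hwl : w l ∈ maximalIdeal R := huw ▸ Ideal.subset_span (Or.inr ⟨l, rfl⟩)
    simpa using (residue_eq_zero_iff _).mp (hloc (w l) hwl)

/-! ## SECOND ORDER -/

include hloc hperf huw hx'm hx'0 hv hc hδadd hδmul hδmem hδsq hdim₁ hhe hspan hθ hf₁ in
/-- **SECOND ORDER — the normal form is contradictory.** In the setting of the first-order engine, suppose the
coefficient matrix `G` has ONE off-diagonal unit entry `G j₁ j₂` and all other off-diagonal entries in `𝔪_R` (the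
normal form reached at stage `i` by completing the product), and some cleaning `f₁ − g'²` of the transformed radicand
lies in `𝔫³`. Then `False`: `v̄_{j₁} = v̄_{j₂} = 0` (first order), `f₁ − g'² = S² + (mu v_{j₁}) v_{j₂} + Θ` with
`Θ ∈ J ∩ 𝔫² = J 𝔫`, `(mu v_{j₁}, v_{j₂}, x', w_l)` start a regular system of parameters of `R₁`, and the cross-term
detector applies. [cite: Matsumura1987, Thm. 17.10] [folklore] -/
theorem false_of_normalForm (j₁ j₂ : Fin h) (h12 : j₁ ≠ j₂) (hunit : IsUnit (G j₁ j₂))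
    (hoff : ∀ j k, j ≠ k → ¬ (j = j₁ ∧ k = j₂) → G j k ∈ maximalIdeal R)
    (hhigh : ∃ g' : R₁, f₁ - g' ^ 2 ∈ maximalIdeal R₁ ^ 3) : False := by
  classical
  set J := Ideal.span (Set.range (Fin.cons x' (fun l => Subring.inclusion hRR₁ (w l)) : Fin (e + 1) → R₁)) with hJ
  set M := Submodule.span (ResidueField R₁)
      (Set.range (Fin.cons (δ x') (fun l => δ (Subring.inclusion hRR₁ (w l))) : Fin (e + 1) → CotangentSpace R₁))
    with hM
  obtain ⟨g', hg'⟩ := hhigh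
  have hJm : J ≤ maximalIdeal R₁ := J_le_maximalIdeal hRR₁ hloc u w huw x' hx'm
  -- ### first order: `v̄_{j₁} = v̄_{j₂} = 0`
  have hker := kernel_of_high hRR₁ hloc hperf u w huw x' hx'm hx'0 v hv c hc δ hδadd hδmul hδmem hδsq hdim₁ hhe
    hspan G θ G' f₁ hθ hf₁ ⟨g', Ideal.pow_le_pow_right (by norm_num) hg'⟩
  set mu' : R₁ := Subring.inclusion hRR₁ (G j₁ j₂) with hmu'
  have hmu'u : IsUnit mu' := hunit.map (Subring.inclusion hRR₁)
  have hmures : residue R₁ mu' ≠ 0 := (hmu'u.map (residue R₁)).ne_zero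
  have h21res : residue R₁ (Subring.inclusion hRR₁ (G j₂ j₁)) = 0 :=
    residue_inclusion_eq_zero hRR₁ hloc (hoff j₂ j₁ h12.symm fun hh => h12 hh.1.symm)
  have hv1 : residue R₁ (v j₁) = 0 := by
    have hk := kernel_single hRR₁ hloc v G j₁ j₂ h12 (fun j hj2 hj1 =>
      ⟨hoff j j₂ hj2 fun hh => hj1 hh.1, hoff j₂ j (Ne.symm hj2) fun hh => h12 hh.1.symm⟩) (hker j₂)
    rw [map_add, map_add, h21res, add_zero] at hk
    exact (mul_eq_zero.mp hk).resolve_left hmures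
  have hv2 : residue R₁ (v j₂) = 0 := by
    have hk := kernel_single hRR₁ hloc v G j₂ j₁ h12.symm (fun j hj1 hj2 =>
      ⟨hoff j j₁ hj1 fun hh => hj1 hh.1, hoff j₁ j (Ne.symm hj1) fun hh => hj2 hh.2⟩) (hker j₁)
    rw [map_add, map_add, h21res, zero_add] at hk
    exact (mul_eq_zero.mp hk).resolve_left hmures
  have hv1m : v j₁ ∈ maximalIdeal R₁ := (residue_eq_zero_iff _).mp hv1
  have hv2m : v j₂ ∈ maximalIdeal R₁ := (residue_eq_zero_iff _).mp hv2
  -- ### the decomposition `f₁ - g'² = S² + z₁ (v j₂) + Θ`, `Θ ∈ J`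
  choose b hb using fun j => hperf (G j j)
  set S₀ : R₁ := ∑ j, Subring.inclusion hRR₁ (b j) * v j with hS₀
  set S : R₁ := S₀ + G' + g' with hS
  set z₁ : R₁ := mu' * v j₁ with hz₁
  set Θ : R₁ := f₁ - g' ^ 2 - S ^ 2 - z₁ * (v j₂) with hΘ
  set T : Fin h → Fin h → R₁ := fun j k => Subring.inclusion hRR₁ (G j k) * v j * v k with hT
  set O : Fin h → Fin h → R₁ := fun j k => if j ≠ k ∧ ¬ (j = j₁ ∧ k = j₂) then T j k else 0 with hO
  have hsplit : ∑ j, ∑ k, T j k = ∑ j, T j j + T j₁ j₂ + ∑ j, ∑ k, O j k := by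
    have hpt : ∀ j k, T j k = (if j = k then T j k else 0) + (if j = j₁ ∧ k = j₂ then T j k else 0) + O j k := by
      intro j k
      simp only [hO]
      by_cases hjk : j = k
      · have hn : ¬ (j = j₁ ∧ k = j₂) := fun hh => h12 (hh.1.symm.trans (hjk.trans hh.2))
        rw [if_pos hjk, if_neg hn, if_neg (fun hh => hh.1 hjk), add_zero, add_zero]
      · by_cases hjj : j = j₁ ∧ k = j₂
        · rw [if_neg hjk, if_pos hjj, if_neg (fun hh => hh.2 hjj), zero_add, add_zero]
        · rw [if_neg hjk, if_neg hjj, if_pos ⟨hjk, hjj⟩, zero_add, zero_add]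
    have hD : ∑ j, ∑ k, (if j = k then T j k else 0) = ∑ j, T j j :=
      Finset.sum_congr rfl fun j _ => by rw [Finset.sum_ite_eq]; simp
    have hU : ∑ j, ∑ k, (if j = j₁ ∧ k = j₂ then T j k else 0) = T j₁ j₂ := by
      rw [Finset.sum_eq_single j₁, Finset.sum_eq_single j₂]
      · simp
      · intro k _ hk; simp [hk]
      · simp
      · intro j _ hj; exact Finset.sum_eq_zero fun k _ => by simp [hj]
      · simp
    calc ∑ j, ∑ k, T j k
        = ∑ j, ∑ k, ((if j = k then T j k else 0) + (if j = j₁ ∧ k = j₂ then T j k else 0) + O j k) :=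
          Finset.sum_congr rfl fun j _ => Finset.sum_congr rfl fun k _ => hpt j k
      _ = ∑ j, ∑ k, (if j = k then T j k else 0) + ∑ j, ∑ k, (if j = j₁ ∧ k = j₂ then T j k else 0) +
            ∑ j, ∑ k, O j k := by
          simp only [Finset.sum_add_distrib]
      _ = _ := by rw [hD, hU]
  have h2 : (2 : R₁) = 0 := CharTwo.two_eq_zero
  have hdiag : ∑ j, T j j = S₀ ^ 2 + ∑ j, Subring.inclusion hRR₁ (G j j - b j ^ 2) * v j ^ 2 := by
    rw [hS₀, sum_pow_char 2, ← Finset.sum_add_distrib]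
    refine Finset.sum_congr rfl fun j _ => ?_
    simp only [hT, map_sub, map_pow]
    ring
  have hT12 : T j₁ j₂ = z₁ * (v j₂) := by simp only [hT, hz₁]; ring
  have hΘeq : Θ = θ + ∑ j, Subring.inclusion hRR₁ (G j j - b j ^ 2) * v j ^ 2 + ∑ j, ∑ k, O j k := by
    simp only [hΘ, hS, hz₁]
    rw [hf₁]
    change ∑ j, ∑ k, T j k + θ + G' ^ 2 - g' ^ 2 - (S₀ + G' + g') ^ 2 - mu' * v j₁ * v j₂ = _
    rw [hsplit, hdiag, hT12, hz₁]
    linear_combination (-(g' ^ 2 + S₀ * G' + S₀ * g' + G' * g')) * h2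
  have hΘJ : Θ ∈ J := by
    rw [hΘeq]
    refine add_mem (add_mem hθ (Ideal.sum_mem _ fun j _ => Ideal.mul_mem_right _ _ ?_))
      (Ideal.sum_mem _ fun j _ => Ideal.sum_mem _ fun k _ => ?_)
    · exact inclusion_mem_J hRR₁ u w huw x' v hv (hb j)
    · simp only [hO]
      split_ifs with hjk
      · simp only [hT]
        exact Ideal.mul_mem_right _ _ (Ideal.mul_mem_right _ _
          (inclusion_mem_J hRR₁ u w huw x' v hv (hoff j k hjk.1 hjk.2)))
      · exact J.zero_mem
  -- ### orders: `S ∈ 𝔫`, `Θ ∈ 𝔫²`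
  have hfg2 : f₁ - g' ^ 2 ∈ maximalIdeal R₁ ^ 2 := Ideal.pow_le_pow_right (by norm_num) hg'
  have hz12 : z₁ * (v j₂) ∈ maximalIdeal R₁ ^ 2 := by
    rw [pow_two]; exact Ideal.mul_mem_mul (Ideal.mul_mem_left _ _ hv1m) hv2m
  have hSm : S ∈ maximalIdeal R₁ := by
    have hS2 : S ^ 2 ∈ maximalIdeal R₁ := by
      have : S ^ 2 = (f₁ - g' ^ 2) - z₁ * (v j₂) - Θ := by simp only [hΘ]; ring
      rw [this]
      exact sub_mem (sub_mem (Ideal.pow_le_self two_ne_zero hfg2) (Ideal.pow_le_self two_ne_zero hz12)) (hJm hΘJ)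
    exact (Ideal.IsPrime.mem_of_pow_mem inferInstance 2 hS2)
  have hΘ2 : Θ ∈ maximalIdeal R₁ ^ 2 := by
    rw [hΘ]
    exact sub_mem (sub_mem hfg2 (Ideal.pow_mem_pow hSm 2)) hz12
  -- ### the classes of `z₁, (v j₂), x', w_l` are linearly independent
  set Z : Fin (e + 1 + 1 + 1) → R₁ := Fin.cons z₁ (Fin.cons (v j₂) (Fin.cons x' (fun l => Subring.inclusion hRR₁ (w l)))) with hZ
  have hZm : ∀ i, Z i ∈ maximalIdeal R₁ := by
    intro i
    refine Fin.cases ?_ (fun i => ?_) i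
    · rw [hZ, Fin.cons_zero]; exact Ideal.mul_mem_left _ _ hv1m
    · rw [hZ, Fin.cons_succ]
      refine Fin.cases ?_ (fun i => ?_) i
      · rw [Fin.cons_zero]; exact hv2m
      · rw [Fin.cons_succ]
        refine Fin.cases ?_ (fun l => ?_) i
        · rw [Fin.cons_zero]; exact hx'm
        · rw [Fin.cons_succ]
          have := hJm (Ideal.subset_span ⟨l.succ, rfl⟩ :
            (Fin.cons x' (fun l => Subring.inclusion hRR₁ (w l)) : Fin (e + 1) → R₁) l.succ ∈ J)
          simpa using this
  have hδZ : ∀ i, (maximalIdeal R₁).toCotangent ⟨Z i, hZm i⟩ = δ (Z i) := fun i => (hδmem _ _).symm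
  have hδz₁ : δ z₁ = residue R₁ mu' • δ (v j₁) := by
    rw [hz₁, hδmul, hv1, zero_smul, add_zero]
  have hli : LinearIndependent (ResidueField R₁) fun i => (maximalIdeal R₁).toCotangent ⟨Z i, hZm i⟩ := by
    simp_rw [hδZ]
    rw [Fintype.linearIndependent_iff]
    intro g hg
    rw [Fin.sum_univ_succ, Fin.sum_univ_succ] at hg
    simp only [hZ, Fin.cons_zero, Fin.cons_succ] at hg
    -- the relation among `δ v_{j₁}, δ v_{j₂}` modulo `M`
    set ev : Fin h → ResidueField R₁ :=
      fun j => (if j = j₁ then g 0 * residue R₁ mu' else 0) + (if j = j₂ then g (Fin.succ 0) else 0) with hev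
    have hevsum : ∑ j, ev j • δ (v j) = g 0 • δ z₁ + g (Fin.succ 0) • δ (v j₂) := by
      have : ∀ j, ev j • δ (v j) = (if j = j₁ then (g 0 * residue R₁ mu') • δ (v j) else 0) +
          (if j = j₂ then g (Fin.succ 0) • δ (v j) else 0) := by
        intro j
        simp only [hev, add_smul, ite_smul, zero_smul]
      rw [Finset.sum_congr rfl fun j _ => this j, Finset.sum_add_distrib, Finset.sum_ite_eq', Finset.sum_ite_eq']
      simp only [Finset.mem_univ, if_true]
      rw [hδz₁, smul_smul]
    have htail : ∑ i : Fin (e + 1), g i.succ.succ • δ ((Fin.cons x' (fun l => Subring.inclusion hRR₁ (w l)) : Fin (e + 1) → R₁) i) ∈ M := by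
      refine M.sum_mem fun i _ => M.smul_mem _ (Submodule.subset_span ⟨i, ?_⟩)
      refine Fin.cases ?_ (fun l => ?_) i <;> simp
    have hevM : ∑ j, ev j • δ (v j) ∈ M := by
      rw [hevsum]
      have : g 0 • δ z₁ + g (Fin.succ 0) • δ (v j₂) =
          -(∑ i : Fin (e + 1), g i.succ.succ • δ ((Fin.cons x' (fun l => Subring.inclusion hRR₁ (w l)) : Fin (e + 1) → R₁) i)) := by
        rw [eq_neg_iff_add_eq_zero, ← hg, Fin.sum_univ_succ]
        simp only [Fin.cons_zero, Fin.cons_succ]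
        abel
      rw [this]
      exact M.neg_mem htail
    obtain ⟨t, ht⟩ := smul_of_relation hRR₁ hloc hperf u w huw x' hx'm hx'0 v hv c hc δ hδadd hδmul hδsq hdim₁ hhe
      hspan ev hevM
    -- pairing with `v̄`: `t = 0`
    have hpair : ∑ j, ev j * residue R₁ (v j) = 0 := by
      have : ∀ j, ev j * residue R₁ (v j) = (if j = j₁ then g 0 * residue R₁ mu' * residue R₁ (v j) else 0) +
          (if j = j₂ then g (Fin.succ 0) * residue R₁ (v j) else 0) := by
        intro j
        simp only [hev, add_mul, ite_mul, zero_mul]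
      rw [Finset.sum_congr rfl fun j _ => this j, Finset.sum_add_distrib, Finset.sum_ite_eq', Finset.sum_ite_eq']
      simp only [Finset.mem_univ, if_true]
      rw [hv1, hv2, mul_zero, mul_zero, zero_add]
    have ht0 : t = 0 := by
      have h1 := sum_residue_c_mul_v hRR₁ u x' hx'0 v hv c hc
      have : ∑ j, ev j * residue R₁ (v j) = t * ∑ j, residue R₁ (Subring.inclusion hRR₁ (c j)) * residue R₁ (v j) := by
        rw [Finset.mul_sum]
        exact Finset.sum_congr rfl fun j _ => by rw [ht j, mul_assoc]
      rw [hpair, h1, mul_one] at this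
      exact this.symm
    have hev0 : ∀ j, ev j = 0 := fun j => by rw [ht j, ht0, zero_mul]
    have hg0 : g 0 = 0 := by
      have := hev0 j₁
      simp only [hev, if_neg h12] at this
      simpa [hmures] using this
    have hg1 : g (Fin.succ 0) = 0 := by
      have := hev0 j₂
      simp only [hev, if_neg h12.symm] at this
      simpa using this
    -- the remaining relation among the old classes
    rw [hg0, hg1, zero_smul, zero_smul, zero_add, zero_add] at hg
    have hold := linearIndependent_old hRR₁ hloc hperf u w huw x' hx'm hx'0 v hv c hc δ hδadd hδmul hδsq hdim₁ hhe
      hspan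
    rw [Fintype.linearIndependent_iff] at hold
    have htail0 := hold (fun i => g i.succ.succ) (by
      convert hg using 1
      refine Finset.sum_congr rfl fun i _ => ?_
      refine Fin.cases ?_ (fun l => ?_) i <;> simp)
    intro i
    refine Fin.cases hg0 (fun i => ?_) i
    refine Fin.cases hg1 (fun i => ?_) i
    exact htail0 i
  -- ### a regular system of parameters starting with `z₁, (v j₂), x', w_l`
  obtain ⟨e'', X, hd, hX, hXZ⟩ := LowOrderDetector.exists_rsop_extending Z hZm hli
  -- `Θ = Σ_l X l * a l` over the indices of `x', w_l`
  obtain ⟨a, ha⟩ := Ideal.mem_span_range_iff_exists_fun.mp hΘJ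
  let emb : Fin (e + 1) → Fin (e + 1 + 1 + 1 + e'') := fun i => Fin.castAdd e'' i.succ.succ
  have hemb : Function.Injective emb := fun i i' hii' => by
    simpa [emb, Fin.castAdd_inj] using hii'
  have hXemb : ∀ i, X (emb i) = (Fin.cons x' (fun l => Subring.inclusion hRR₁ (w l)) : Fin (e + 1) → R₁) i := by
    intro i
    rw [hXZ]
    simp [hZ]
  set L : Finset (Fin (e + 1 + 1 + 1 + e'')) := Finset.univ.image emb with hL
  set a' : Fin (e + 1 + 1 + 1 + e'') → R₁ := fun l => ∑ i, if emb i = l then a i else 0 with ha'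
  have ha'emb : ∀ i, a' (emb i) = a i := by
    intro i
    simp only [ha']
    rw [Finset.sum_eq_single i]
    · simp
    · intro i' _ hi'; rw [if_neg]; exact fun hh => hi' (hemb hh)
    · simp
  have hΘsum : Θ = ∑ l ∈ L, X l * a' l := by
    rw [hL, Finset.sum_image fun i _ i' _ hh => hemb hh, ← ha]
    refine Finset.sum_congr rfl fun i _ => ?_
    rw [ha'emb, hXemb, mul_comm]
  have ha'm : ∀ l ∈ L, a' l ∈ maximalIdeal R₁ :=
    LowOrderDetector.mem_maximalIdeal_of_sum_mul_mem_sq hd X hX L a' (hΘsum ▸ hΘ2)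
  -- ### the cross-term detector
  set i₁ : Fin (e + 1 + 1 + 1 + e'') := Fin.castAdd e'' 0 with hi₁
  set i₂ : Fin (e + 1 + 1 + 1 + e'') := Fin.castAdd e'' (Fin.succ 0) with hi₂
  have hi12 : i₁ ≠ i₂ := by
    rw [hi₁, hi₂]
    intro hh
    exact (Fin.succ_ne_zero 0) (Fin.castAdd_inj.mp hh).symm
  have hL₁ : i₁ ∉ L := by
    simp only [hL, Finset.mem_image, Finset.mem_univ, true_and, not_exists, emb, hi₁]
    intro i hh
    exact Fin.succ_ne_zero _ (Fin.castAdd_inj.mp hh)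
  have hL₂ : i₂ ∉ L := by
    simp only [hL, Finset.mem_image, Finset.mem_univ, true_and, not_exists, emb, hi₂]
    intro i hh
    exact Fin.succ_ne_zero _ (Fin.succ_injective _ (Fin.castAdd_inj.mp hh))
  have hX1 : X i₁ = z₁ := by rw [hi₁, hXZ, hZ, Fin.cons_zero]
  have hX2 : X i₂ = (v j₂) := by rw [hi₂, hXZ, hZ, Fin.cons_succ, Fin.cons_zero]
  have hnot := LowOrderDetector.cross_term_not_mem_pow_three hd X hX i₁ i₂ hi12 L hL₁ hL₂ S hSm a' ha'm
  apply hnot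
  rw [hX1, hX2, ← hΘsum]
  have : S ^ 2 + z₁ * (v j₂) + Θ = f₁ - g' ^ 2 := by simp only [hΘ]; ring
  rw [this]
  exact hg'

end Summit.ResolutionOfSingularities.ResolutionOfSingularities.Theorems.SwitchingDichotomy.LowOrderSecond

end
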